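import Summits.Ventures.Crystal3D.Bulk.ConvexPositionGluing
import Summits.Ventures.Crystal3D.Bulk.SphSegmentCap
import HarnessLib

/-!
# Caps inside a convex spherical polygon: the edge lemma and the global cap lemma (edge LINES
# stay away from an interior point that is far from the edge SEGMENTS) — bricks for (d3)

HONEST FRAMING. Part of the venture `Summits/Ventures/Crystal3D` (cell `pub-crystal3d`, phase 2;
seat typer-bulk-2), generic and configuration-free: a polygon `w 0, …, w (n−1)` of vectors of
`ℝ³`, extended periodically (`w (i+n) = w i`), in WINDOW CONVEX POSITION
`∀ i < j < k < i+n, 0 < orient3 (w i) (w j) (w k)` — the periodic form (`convexPos_window`) of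
the convex position of `Bulk/ConvexPositionGluing.lean`, which census faces supply after reversal
(`CensusRows.cw_oface`). Nothing here mentions GAP(1.26). The first step of the perimeter proof
of (d3) «a p-hexagon hosts at most one rattler» (`phase2/theory1/HEX-PERIMETER.md`, plan
`HOME/lean/hexper/README.md`): a rattler `z` interior to the convex face, at spherical distance
`≥ r₀` from every SIDE, has every side's GREAT CIRCLE at distance `≥ r₀` (its whole `r₀`-cap lies
in the face). Contents:

* `convexPos_window`, `periodic_add_mul`, `orient3_edge_mod`, `forall_edge_of_forall_lt` —
  periodic bookkeeping;
* **edge lemma** `exists_nonneg_combo_of_orient3_eq_zero` — a point on the nonnegative side of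
  the two neighbouring edge planes and ON the plane of edge `i` is a nonnegative combination of
  `w i, w (i+1)`;
* `orient3_pos_of_segments` — a unit point of the closed polygonal cone at distance
  `≥ arccos √M` (`M < 1`) from every edge segment is STRICTLY inside;
* **global cap lemma** `sqrt_mul_norm_cross3_le_orient3` — for such a point,
  `√(1−M) ‖w i × w (i+1)‖ ≤ orient3 (w i) (w (i+1)) z` for every edge (proof: otherwise the foot
  of `z` on that plane lies outside the cone, and the chord from `z` to it leaves the cone —
  first exit = a finite minimum of exit parameters, no topology — through a point of some edge
  segment that is too close to `z`; the real-number endgame is `cap_endgame`).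
-/

noncomputable section

namespace Summit.Ventures.Crystal3D

open Literature.Geometry.DiscreteGeometry Real InnerProductGeometry Finset
open scoped InnerProductSpace RealInnerProductSpace

/-! ## Part C. Window convex position and the edge lemma -/

section Polygon

variable {n : ℕ} {w : ℕ → EuclideanSpace ℝ (Fin 3)}

/-- Window convex position from the standard convex position of one period plus periodicity. -/
theorem convexPos_window (hn : 3 ≤ n) (hper : ∀ i, w (i + n) = w i)
    (hw : ∀ i j k, i < j → j < k → k < n → 0 < orient3 (w i) (w j) (w k)) :
    ∀ i j k, i < j → j < k → k < i + n → 0 < orient3 (w i) (w j) (w k) := by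
  -- reduce `i` below `n` by periodicity, then split on whether `j`, `k` pass the period
  have hperk : ∀ i q, w (i + q * n) = w i := by
    intro i q
    induction q with
    | zero => simp
    | succ q ih => rw [Nat.succ_mul, ← add_assoc, hper, ih]
  intro i j k hij hjk hk
  obtain ⟨q, i₀, hi₀, rfl⟩ : ∃ q i₀, i₀ < n ∧ i = i₀ + q * n :=
    ⟨i / n, i % n, Nat.mod_lt _ (by omega), (Nat.mod_add_div' i n).symm⟩
  obtain ⟨j₀, rfl⟩ : ∃ j₀, j = j₀ + q * n := ⟨j - q * n, by omega⟩
  obtain ⟨k₀, rfl⟩ : ∃ k₀, k = k₀ + q * n := ⟨k - q * n, by omega⟩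
  rw [hperk, hperk, hperk]
  have hij₀ : i₀ < j₀ := by omega
  have hjk₀ : j₀ < k₀ := by omega
  have hk₀ : k₀ < i₀ + n := by omega
  by_cases hkn : k₀ < n
  · exact hw i₀ j₀ k₀ hij₀ hjk₀ hkn
  · obtain ⟨k₁, rfl⟩ : ∃ k₁, k₀ = k₁ + n := ⟨k₀ - n, by omega⟩
    rw [hper]
    by_cases hjn : j₀ < n
    · -- triple `k₁ < i₀ < j₀` up to the cyclic rotation `(i₀, j₀, k₁)`
      rw [← orient3_cyclic]
      exact hw k₁ i₀ j₀ (by omega) hij₀ hjn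
    · obtain ⟨j₁, rfl⟩ : ∃ j₁, j₀ = j₁ + n := ⟨j₀ - n, by omega⟩
      rw [hper, orient3_cyclic]
      exact hw j₁ k₁ i₀ (by omega) (by omega) hi₀

variable (hn : 3 ≤ n) (hper : ∀ i, w (i + n) = w i)
  (hcx : ∀ i j k, i < j → j < k → k < i + n → 0 < orient3 (w i) (w j) (w k))
include hn hper hcx

omit hper in
/-- Consecutive triples are positively oriented. -/
theorem orient3_window_consec_pos (i : ℕ) : 0 < orient3 (w i) (w (i + 1)) (w (i + 2)) :=
  hcx i (i + 1) (i + 2) (by omega) (by omega) (by omega)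

/-- **Edge lemma.** A point `x` on the nonnegative side of the edges `i − 1` and `i + 1`
(indices through the period: edge `i + n − 1` and edge `i + 1`) lying ON the plane of edge `i`
is a nonnegative combination of `w i` and `w (i+1)`. -/
theorem exists_nonneg_combo_of_orient3_eq_zero {x : EuclideanSpace ℝ (Fin 3)} (i : ℕ)
    (hprev : 0 ≤ orient3 (w (i + n - 1)) (w (i + n)) x)
    (hnext : 0 ≤ orient3 (w (i + 1)) (w (i + 2)) x) (h0 : orient3 (w i) (w (i + 1)) x = 0) :
    ∃ a b : ℝ, 0 ≤ a ∧ 0 ≤ b ∧ x = a • w i + b • w (i + 1) := by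
  have hD := orient3_window_consec_pos hn hcx i
  -- Cramer in the basis `w i, w (i+1), w (i+2)`; the third coefficient vanishes
  have hexp := orient3_expand (w i) (w (i + 1)) (w (i + 2)) x
  rw [h0, zero_smul, add_zero] at hexp
  set D := orient3 (w i) (w (i + 1)) (w (i + 2)) with hDdef
  set A := orient3 x (w (i + 1)) (w (i + 2)) with hAdef
  set B := orient3 (w i) x (w (i + 2)) with hBdef
  have hx : x = (D⁻¹ * A) • w i + (D⁻¹ * B) • w (i + 1) := by
    have h := congrArg (fun v => D⁻¹ • v) hexp
    simp only [smul_add, smul_smul, inv_mul_cancel₀ hD.ne', one_smul] at h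
    exact h
  refine ⟨D⁻¹ * A, D⁻¹ * B, ?_, ?_, hx⟩
  · -- `A` is the functional of edge `i + 1` at `x`
    have hA : A = orient3 (w (i + 1)) (w (i + 2)) x := by rw [hAdef, orient3_cyclic]
    rw [hA]
    exact mul_nonneg (inv_nonneg.2 hD.le) hnext
  · -- `B`: evaluate the functional of edge `i − 1` (= edge `i + n − 1`) at `x`
    have hwin : w (i + n) = w i := hper i
    have hD' : 0 < orient3 (w (i + n - 1)) (w i) (w (i + 1)) := by
      have := hcx (i + n - 1) (i + n) (i + 1 + n) (by omega) (by omega) (by omega)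
      rwa [hper (i + 1), hwin] at this
    have heval : orient3 (w (i + n - 1)) (w (i + n)) x =
        (D⁻¹ * B) * orient3 (w (i + n - 1)) (w i) (w (i + 1)) := by
      rw [hwin]
      conv_lhs => rw [hx]
      rw [orient3_add_right, orient3_smul_right, orient3_smul_right, orient3_self_right, mul_zero,
        zero_add]
    rw [heval] at hprev
    exact (mul_nonneg_iff_of_pos_right hD').1 hprev

/-! ## Part D. Periodic bookkeeping, strict interior, and the global cap lemma -/

omit hn hcx in
/-- Periodicity over several periods. -/
theorem periodic_add_mul (i q : ℕ) : w (i + q * n) = w i := by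
  induction q with
  | zero => simp
  | succ q ih => rw [Nat.succ_mul, ← add_assoc, hper, ih]

omit hn hcx in
/-- The edge functionals only depend on the edge index modulo the period. -/
theorem orient3_edge_mod (x : EuclideanSpace ℝ (Fin 3)) (i : ℕ) :
    orient3 (w i) (w (i + 1)) x = orient3 (w (i % n)) (w (i % n + 1)) x := by
  conv_lhs => rw [← Nat.mod_add_div' i n, show i % n + i / n * n + 1 = (i % n + 1) + i / n * n by ring,
    periodic_add_mul hper, periodic_add_mul hper]

omit hcx in
/-- A family of edge conditions stated for `i < n` holds for every index. -/
theorem forall_edge_of_forall_lt {x : EuclideanSpace ℝ (Fin 3)} {P : ℝ → Prop}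
    (h : ∀ i, i < n → P (orient3 (w i) (w (i + 1)) x)) : ∀ i, P (orient3 (w i) (w (i + 1)) x) := by
  intro i
  rw [orient3_edge_mod hper]
  exact h _ (Nat.mod_lt _ (by omega))

/-- **Strict interior.** A unit point of the closed polygonal cone which is at spherical
distance `≥ arccos √M` (`M < 1`) from every edge segment lies STRICTLY inside every edge plane
(it cannot lie on an edge). -/
theorem orient3_pos_of_segments {z : EuclideanSpace ℝ (Fin 3)} (hz : ‖z‖ = 1) {M : ℝ} (hM1 : M < 1)
    (hin : ∀ i, 0 ≤ orient3 (w i) (w (i + 1)) z)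
    (hseg : ∀ i, ∀ a b : ℝ, 0 ≤ a → 0 ≤ b →
      ⟪z, a • w i + b • w (i + 1)⟫ ≤ Real.sqrt M * ‖a • w i + b • w (i + 1)‖) :
    ∀ i, 0 < orient3 (w i) (w (i + 1)) z := by
  intro i
  refine (hin i).lt_of_ne fun h0 => ?_
  have hprev : 0 ≤ orient3 (w (i + n - 1)) (w (i + n)) z := by
    have := hin (i + n - 1); rwa [show i + n - 1 + 1 = i + n by omega] at this
  obtain ⟨a, b, ha, hb, hzab⟩ :=
    exists_nonneg_combo_of_orient3_eq_zero hn hper hcx i hprev (hin (i + 1)) h0.symm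
  have h := hseg i a b ha hb
  rw [← hzab, real_inner_self_eq_norm_sq, hz] at h
  have hs : Real.sqrt M < 1 := by
    rcases le_or_gt 0 M with hM0 | hM0
    · calc Real.sqrt M < Real.sqrt 1 := Real.sqrt_lt_sqrt hM0 hM1
        _ = 1 := Real.sqrt_one
    · rw [Real.sqrt_eq_zero'.2 hM0.le]; exact one_pos
  norm_num at h
  linarith

omit hn hper hcx in
/-- The real-number endgame of the global cap lemma: with `P = 1 − L g²`, `Q = 1 − 2Lg² + L²g²`
(`0 < g`, `g² < 1 − M`, `0 < L < 1`) one has `(1 − g²) Q ≤ P²` and `P > 0`, so `P ≤ √M √Q`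
is impossible. -/
theorem cap_endgame {M g L P Q : ℝ} (hM0 : 0 ≤ M) (hg2 : g ^ 2 < 1 - M) (hL0 : 0 < L)
    (hL1 : L < 1) (hP : P = 1 - L * g ^ 2) (hQ : Q = 1 - 2 * L * g ^ 2 + L ^ 2 * g ^ 2)
    (hQ0 : 0 ≤ Q) (hle : P ≤ Real.sqrt M * Real.sqrt Q) : False := by
  have hg21 : g ^ 2 ≤ 1 := by linarith
  have hPpos : 0 < P := by rw [hP]; nlinarith
  have hid : P ^ 2 - (1 - g ^ 2) * Q = g ^ 2 * (1 - L) * (1 + L - 2 * L * g ^ 2) := by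
    rw [hP, hQ]; ring
  have hfac : 0 ≤ g ^ 2 * (1 - L) * (1 + L - 2 * L * g ^ 2) := by
    apply mul_nonneg (mul_nonneg (sq_nonneg g) (by linarith))
    nlinarith [mul_le_mul_of_nonneg_left hg21 (by linarith : (0:ℝ) ≤ 2 * L)]
  have hkey : (1 - g ^ 2) * Q ≤ P ^ 2 := by linarith
  have hsq : P ^ 2 ≤ M * Q := by
    have h := mul_le_mul hle hle hPpos.le (mul_nonneg (Real.sqrt_nonneg _) (Real.sqrt_nonneg _))
    rw [← pow_two, ← pow_two, mul_pow, Real.sq_sqrt hM0, Real.sq_sqrt hQ0] at h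
    exact h
  have hQle : Q ≤ 0 := by nlinarith
  have hQz : Q = 0 := le_antisymm hQle hQ0
  rw [hQz, mul_zero] at hsq
  nlinarith

/-- **Global cap lemma.** Let the unit vector `z` lie strictly inside the polygon and be at
spherical distance `≥ arccos √M` (`0 ≤ M < 1`) from every edge SEGMENT (the per-edge bound
`⟪z, a w i + b w (i+1)⟫ ≤ √M ‖a w i + b w (i+1)‖`, `a, b ≥ 0`). Then `z` is at distance
`≥ arccos √M` from every edge GREAT CIRCLE: `√(1−M) ‖w i × w (i+1)‖ ≤ orient3 (w i) (w (i+1)) z`,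
i.e. the whole cap of angular radius `arccos √M` about `z` lies inside the polygon. -/
theorem sqrt_mul_norm_cross3_le_orient3 {z : EuclideanSpace ℝ (Fin 3)} (hz : ‖z‖ = 1) {M : ℝ} (hM0 : 0 ≤ M)
    (hM1 : M < 1) (hin : ∀ i, 0 < orient3 (w i) (w (i + 1)) z)
    (hseg : ∀ i, ∀ a b : ℝ, 0 ≤ a → 0 ≤ b →
      ⟪z, a • w i + b • w (i + 1)⟫ ≤ Real.sqrt M * ‖a • w i + b • w (i + 1)‖) (i : ℕ) :
    Real.sqrt (1 - M) * ‖cross3 (w i) (w (i + 1))‖ ≤ orient3 (w i) (w (i + 1)) z := by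
  -- the unit normal `u` of the edge plane and the height `g = ⟪u, z⟫ > 0`
  have hN : cross3 (w i) (w (i + 1)) ≠ 0 := cross3_ne_zero_of_orient3_ne_zero (hin i).ne'
  have hNpos : 0 < ‖cross3 (w i) (w (i + 1))‖ := norm_pos_iff.2 hN
  obtain ⟨u, hu⟩ : ∃ u : EuclideanSpace ℝ (Fin 3), u = ‖cross3 (w i) (w (i + 1))‖⁻¹ • cross3 (w i) (w (i + 1)) :=
    ⟨_, rfl⟩
  have hu1 : ‖u‖ = 1 := by
    rw [hu, norm_smul, norm_inv, norm_norm, inv_mul_cancel₀ hNpos.ne']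
  have huu : ⟪u, u⟫ = 1 := by rw [real_inner_self_eq_norm_sq, hu1, one_pow]
  have hzz : ⟪z, z⟫ = 1 := by rw [real_inner_self_eq_norm_sq, hz, one_pow]
  have hfun : ∀ x : EuclideanSpace ℝ (Fin 3), orient3 (w i) (w (i + 1)) x = ‖cross3 (w i) (w (i + 1))‖ * ⟪u, x⟫ := by
    intro x
    rw [hu, real_inner_smul_left, inner_cross3_left, ← mul_assoc, mul_inv_cancel₀ hNpos.ne',
      one_mul]
  obtain ⟨g, hg⟩ : ∃ g : ℝ, g = ⟪u, z⟫ := ⟨_, rfl⟩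
  have hgpos : 0 < g := by
    have h := hin i
    rw [hfun, ← hg] at h
    exact pos_of_mul_pos_right h hNpos.le
  -- it suffices to bound the height
  suffices hsg : Real.sqrt (1 - M) ≤ g by
    rw [hfun, ← hg]
    nlinarith [mul_le_mul_of_nonneg_right hsg hNpos.le]
  by_contra hlt
  rw [not_le] at hlt
  -- `g² < 1 − M`
  have hg2 : g ^ 2 < 1 - M := by
    have h1 : g ^ 2 < Real.sqrt (1 - M) ^ 2 := pow_lt_pow_left₀ hlt hgpos.le two_ne_zero
    rwa [Real.sq_sqrt (by linarith)] at h1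
  -- the foot `f = z − g u` of `z` on the edge plane
  obtain ⟨f, hf⟩ : ∃ f : EuclideanSpace ℝ (Fin 3), f = z - g • u := ⟨_, rfl⟩
  have huz : ⟪u, z⟫ = g := hg.symm
  have hzu : ⟪z, u⟫ = g := by rw [real_inner_comm]; exact huz
  have hf0 : orient3 (w i) (w (i + 1)) f = 0 := by
    rw [hfun, hf, inner_sub_right, real_inner_smul_right, huz, huu, mul_one, sub_self, mul_zero]
  have hzf : ⟪z, f⟫ = 1 - g ^ 2 := by
    rw [hf, inner_sub_right, real_inner_smul_right, hzz, hzu]; ring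
  have hfz : ⟪f, z⟫ = 1 - g ^ 2 := by rw [real_inner_comm]; exact hzf
  have hff : ⟪f, f⟫ = 1 - g ^ 2 := by
    rw [hf, inner_sub_left, inner_sub_right, inner_sub_right, real_inner_smul_left,
      real_inner_smul_right, real_inner_smul_left, real_inner_smul_right, hzz, hzu, huz, huu]
    ring
  -- Step 1: the foot is outside the cone
  have hout : ∃ j, j < n ∧ orient3 (w j) (w (j + 1)) f < 0 := by
    by_contra hall
    have hall' : ∀ j, j < n → 0 ≤ orient3 (w j) (w (j + 1)) f := by
      intro j hj
      by_contra hneg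
      exact hall ⟨j, hj, lt_of_not_ge hneg⟩
    have hallp : ∀ j, 0 ≤ orient3 (w j) (w (j + 1)) f :=
      forall_edge_of_forall_lt hn hper (P := fun t => 0 ≤ t) hall'
    have hprev : 0 ≤ orient3 (w (i + n - 1)) (w (i + n)) f := by
      have := hallp (i + n - 1); rwa [show i + n - 1 + 1 = i + n by omega] at this
    obtain ⟨a, b, ha, hb, hfab⟩ :=
      exists_nonneg_combo_of_orient3_eq_zero hn hper hcx i hprev (hallp (i + 1)) hf0
    have h := hseg i a b ha hb
    rw [← hfab, hzf] at h
    -- `1 − g² ≤ √M ‖f‖` with `‖f‖ = √(1 − g²)` forces `1 − g² ≤ M`: endgame with `L = 1`... direct: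
    have hfn : ‖f‖ = Real.sqrt (1 - g ^ 2) := by
      rw [← Real.sqrt_sq (norm_nonneg f), ← real_inner_self_eq_norm_sq, hff]
    rw [hfn] at h
    have hm0 : 0 < 1 - g ^ 2 := by linarith
    have hsm : 0 < Real.sqrt (1 - g ^ 2) := Real.sqrt_pos.2 hm0
    have h2 : Real.sqrt (1 - g ^ 2) * Real.sqrt (1 - g ^ 2) ≤
        Real.sqrt M * Real.sqrt (1 - g ^ 2) := by
      rw [Real.mul_self_sqrt hm0.le]; exact h
    have h3 : Real.sqrt (1 - g ^ 2) ≤ Real.sqrt M := le_of_mul_le_mul_right h2 hsm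
    have h4 : 1 - g ^ 2 ≤ M := by
      have := mul_le_mul h3 h3 hsm.le (Real.sqrt_nonneg _)
      rwa [Real.mul_self_sqrt hm0.le, Real.mul_self_sqrt hM0] at this
    linarith
  -- Step 2: the first exit of the chord `z → f` from the cone (a finite minimum)
  classical
  obtain ⟨J, hJ⟩ : ∃ J : Finset ℕ,
      J = (range n).filter fun j => orient3 (w j) (w (j + 1)) f < 0 := ⟨_, rfl⟩
  have hmemJ : ∀ j, j ∈ J ↔ j < n ∧ orient3 (w j) (w (j + 1)) f < 0 := by
    intro j; rw [hJ, mem_filter, mem_range]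
  have hJne : J.Nonempty := by
    obtain ⟨j, hj, hneg⟩ := hout
    exact ⟨j, (hmemJ j).2 ⟨hj, hneg⟩⟩
  obtain ⟨lam, hlam⟩ : ∃ lam : ℕ → ℝ, lam = fun j => orient3 (w j) (w (j + 1)) z /
      (orient3 (w j) (w (j + 1)) z - orient3 (w j) (w (j + 1)) f) := ⟨_, rfl⟩
  obtain ⟨jm, hjmJ, hjm⟩ := exists_mem_eq_inf' hJne lam
  obtain ⟨L, hL⟩ : ∃ L : ℝ, L = J.inf' hJne lam := ⟨_, rfl⟩
  have hLle : ∀ j ∈ J, L ≤ lam j := fun j hj => by rw [hL]; exact inf'_le _ hj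
  have hLeq : L = lam jm := by rw [hL, hjm]
  obtain ⟨-, hjmneg⟩ := (hmemJ jm).1 hjmJ
  have hden : ∀ j, orient3 (w j) (w (j + 1)) f < 0 →
      0 < orient3 (w j) (w (j + 1)) z - orient3 (w j) (w (j + 1)) f := fun j hj => by
    linarith [hin j]
  have hLd : L * (orient3 (w jm) (w (jm + 1)) z - orient3 (w jm) (w (jm + 1)) f) =
      orient3 (w jm) (w (jm + 1)) z := by
    rw [hLeq, hlam]
    exact div_mul_cancel₀ _ (hden jm hjmneg).ne'
  have hL0 : 0 < L := by
    rw [hLeq, hlam]; exact div_pos (hin jm) (hden jm hjmneg)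
  have hL1 : L < 1 := by
    rw [hLeq, hlam, div_lt_one (hden jm hjmneg)]; linarith
  -- the exit point `q`
  obtain ⟨q, hq⟩ : ∃ q : EuclideanSpace ℝ (Fin 3), q = (1 - L) • z + L • f := ⟨_, rfl⟩
  have hqfun : ∀ j, orient3 (w j) (w (j + 1)) q =
      (1 - L) * orient3 (w j) (w (j + 1)) z + L * orient3 (w j) (w (j + 1)) f := by
    intro j; rw [hq, orient3_add_right, orient3_smul_right, orient3_smul_right]
  have hqin_lt : ∀ j, j < n → 0 ≤ orient3 (w j) (w (j + 1)) q := by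
    intro j hj
    rw [hqfun]
    rcases le_or_gt 0 (orient3 (w j) (w (j + 1)) f) with hfj | hfj
    · exact add_nonneg (mul_nonneg (by linarith) (hin j).le) (mul_nonneg hL0.le hfj)
    · have h1 := hLle j ((hmemJ j).2 ⟨hj, hfj⟩)
      rw [hlam] at h1
      have h2 := (le_div_iff₀ (hden j hfj)).1 h1
      rw [mul_sub] at h2
      linarith
  have hqin : ∀ j, 0 ≤ orient3 (w j) (w (j + 1)) q :=
    forall_edge_of_forall_lt hn hper (P := fun t => 0 ≤ t) hqin_lt
  have hq0 : orient3 (w jm) (w (jm + 1)) q = 0 := by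
    rw [hqfun]; linear_combination (-1 : ℝ) * hLd
  -- so `q` lies on the edge segment `jm`
  have hprevq : 0 ≤ orient3 (w (jm + n - 1)) (w (jm + n)) q := by
    have := hqin (jm + n - 1); rwa [show jm + n - 1 + 1 = jm + n by omega] at this
  obtain ⟨a, b, ha, hb, hqab⟩ :=
    exists_nonneg_combo_of_orient3_eq_zero hn hper hcx jm hprevq (hqin (jm + 1)) hq0
  have hsegq := hseg jm a b ha hb
  rw [← hqab] at hsegq
  -- the algebra: `⟪z, q⟫ = 1 − L g²`, `‖q‖² = 1 − 2 L g² + L² g²`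
  have hzq : ⟪z, q⟫ = 1 - L * g ^ 2 := by
    rw [hq, inner_add_right, real_inner_smul_right, real_inner_smul_right, hzz, hzf]; ring
  have hqq : ‖q‖ ^ 2 = 1 - 2 * L * g ^ 2 + L ^ 2 * g ^ 2 := by
    rw [← real_inner_self_eq_norm_sq, hq]
    simp only [inner_add_left, inner_add_right, real_inner_smul_left, real_inner_smul_right, hzz,
      hzf, hfz, hff]
    ring
  have hqn : ‖q‖ = Real.sqrt (1 - 2 * L * g ^ 2 + L ^ 2 * g ^ 2) := by
    rw [← hqq, Real.sqrt_sq (norm_nonneg _)]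
  rw [hzq, hqn] at hsegq
  exact cap_endgame hM0 hg2 hL0 hL1 rfl rfl (by rw [← hqq]; exact sq_nonneg _) hsegq

end Polygon

end Summit.Ventures.Crystal3D

end
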